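import Mathlib
import HarnessLib
import Summits.HubbardSuperconductivity.HubbardSuperconductivity.Theorems.KLProgrammeKLRegimeTwoVolumeSrcTowerIdentity
import Summits.HubbardSuperconductivity.HubbardSuperconductivity.Theorems.KLProgrammeKLRegimeTwoVolumeSectorOverlapPeriodisation
import Summits.HubbardSuperconductivity.HubbardSuperconductivity.Theorems.KLProgrammeKLRegimeTwoVolumeSectorPeriodisation
import Summits.HubbardSuperconductivity.HubbardSuperconductivity.Theorems.KLProgrammeKLRegimeTwoVolumeSampledSliceData

/-!
# Route `KLProgramme` — crux K3, VL child `KLRegimeVolumeLimitV17F2` (stmt-HubbardSuperconductivity-20440), blueprint v5 M5: THE OBJECTS OF THE DOUBLED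
# SOURCE-CARRYING TOWER (definitions; seat hubbard-kl-k3c4-p1 g12; `--supports` 20440)

The nested two-volume induction (memo M5-DESIGN, NOTES «tower of record v6») runs on the following objects of ONE volume `L` at a frame `K` (in the
model `K = klFlowFrameU L M β U μ (nScales β + 1)`), scale by scale.  This file NAMES them, so that the composition files state their hypotheses about
named matrices and actions instead of forty-line `Matrix.of` terms:

* `klStepCov L M β μ K k` — the step covariance of scale `k` in the fat sectors of scale `k`:
  `S(F̃_k[K])ᵀ · C^K_{(Λ_{k+2},Λ_{k+1}]} · S(F̃_k[K])`; `klStepCovD` — its spectator lift to the doubled legs `SrcLabel L M k` (copy `0` only);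
* `klSlotShift L M k` — the slot-`0` identity `SectorLeg (sectorCount k) → SectorLeg (sectorCount (k+1))` of the plain source block;
  `klReanalysis L M β μ K k = (ε • E(F_{k+1}[K])) · S(F̃_k[K])`; `klSrcTransfer L M β μ K k` — the doubled transfer `T⁺_k = klReanalysis ⊕ klSlotShift`;
* `klTowerD L M β U μ K k = map (toLin' (ε • klSrcAnalysisAt … k)) 𝒱_{k+1}[K]` — the doubled source-carrying action of scale `k+1` analysed at level `k`
  (the sub-diagonal read-out, NOTES «(VL)-SUBDIAG-READOUT»); the END door (k3c5-p3 p589727) reads `klTowerD … (nScales β)`;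
* `klTowerState L M β U μ K j` / `klTowerTransfer L M β μ K j` — the STATE of the induction at step `j` and the transfer it is re-analysed with:
  `j = 0`: `(klTowerD … 0, 1)`; `j = k+1`: `(effAction (klStepCovD … k) (klTowerD … k), klSrcTransfer … k)`.

API (all the composition uses): the `Matrix.of` unfoldings; `klTowerState_succ` (rfl); **`klTowerD_succ_eq_map`** (`D_{k+2} = map T⁺_k (effAction C⁺_k D_{k+1})`,
= `…SrcTowerIdentity.klSrcTower_succ_eq_map_doubleBlock_effAction`, p588642); **`map_klTowerTransfer_klTowerState`** (`map T_j (state j) = klTowerD j`: the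
induction's step `j → j+1` is literally `state (j+1) = effAction C⁺_j (map T_j (state j))`, the shape of `…SrcSectorScaleSuccBundledP`); the PERIODISATION
identities of `klReanalysis` (two volumes, common frame: `sectorOverlap_periodise_leg` with the sampled families of `…SectorPeriodisation` /
`…SampledSliceData`), of `klSlotShift`, and of the identity transfer.  Definitions with bodies; nothing about the model is asserted beyond p588642's identity.
-/

noncomputable section

namespace Summit.HubbardSuperconductivity.HubbardSuperconductivity.Theorems.TwoVolumeSource

set_option linter.dupNamespace false -- summit = problem name (single-conjunct summit), D-0017

open Finset Literature.MathematicalPhysics.QuantumLattice Literature.Probability.LatticeModels GrassmannAlgebra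
open Summit.HubbardSuperconductivity.HubbardSuperconductivity.Theorems.KLProgrammeLegKernels
open Summit.HubbardSuperconductivity.HubbardSuperconductivity.Theorems.KLRegimeSplit
open Summit.HubbardSuperconductivity.HubbardSuperconductivity.Theorems.EngineV8
open Summit.HubbardSuperconductivity.HubbardSuperconductivity.Theorems.TwoPointAssembly
open Summit.HubbardSuperconductivity.HubbardSuperconductivity.Theorems.TwoVolumeDefect

variable (L M : ℕ) [NeZero L] [NeZero M]

/-! ## §1 The matrices of one scale -/

/-- **The step covariance of scale `k`** in the fat sectors of scale `k` at frame `K`: `S(F̃_k)ᵀ · C^K_{(Λ_{k+2},Λ_{k+1}]} · S(F̃_k)`.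
[cite: BenfattoGiulianiMastropietro2006, §2.7 (2.70)] -/
def klStepCov (β μ : ℝ) (K : TrigPolyC4v) (k : ℕ) :
    Matrix (SpaceTimeIdx L M × SectorLeg (sectorCount k)) (SpaceTimeIdx L M × SectorLeg (sectorCount k)) ℂ :=
  (sectorSubMatrix L M β (bgmFatMultiplier L M klE0 β (nambuXiCT L μ K) k)).transpose *
      hubbardCovSliceCT L M β μ 0 K (klScale klE0 (k + 2)) (klScale klE0 (k + 1)) *
    sectorSubMatrix L M β (bgmFatMultiplier L M klE0 β (nambuXiCT L μ K) k)

/-- **Its spectator lift to the doubled legs** (copy `0` carries the covariance, the source copy `1` is a spectator). -/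
def klStepCovD (β μ : ℝ) (K : TrigPolyC4v) (k : ℕ) : Matrix (SrcLabel L M k) (SrcLabel L M k) ℂ :=
  Matrix.of fun p q => if p.2 = 0 ∧ q.2 = 0 then klStepCov L M β μ K k p.1 q.1 else 0

/-- **The slot-`0` identity** between the plain source blocks at two consecutive sector counts (same site, sector slot `0`, same spin and charge). -/
def klSlotShift (k : ℕ) : Matrix (SpaceTimeIdx L M × SectorLeg (sectorCount (k + 1))) (SpaceTimeIdx L M × SectorLeg (sectorCount k)) ℂ :=
  Matrix.of fun Y' Y => if Y'.1 = Y.1 ∧ (Y'.2.1.1 : ℕ) = 0 ∧ (Y.2.1.1 : ℕ) = 0 ∧ Y'.2.1.2 = Y.2.1.2 ∧ Y'.2.2 = Y.2.2 then 1 else 0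

/-- **The re-analysis block of scale `k`**: `(ε • E(F_{k+1})) · S(F̃_k)`, `ε = imagTimeWeight β M`. [cite: BenfattoGiulianiMastropietro2006, §2.7 (2.71)] -/
def klReanalysis (β μ : ℝ) (K : TrigPolyC4v) (k : ℕ) :
    Matrix (SpaceTimeIdx L M × SectorLeg (sectorCount (k + 1))) (SpaceTimeIdx L M × SectorLeg (sectorCount k)) ℂ :=
  ((((imagTimeWeight β M : ℝ) : ℂ)) • sectorAnalysisMatrix L M β (klAnisoFamily L M β μ K klE0 (k + 1))) *
    sectorSubMatrix L M β (bgmFatMultiplier L M klE0 β (nambuXiCT L μ K) k)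

/-- **The doubled transfer `T⁺_k`**: `klReanalysis` on copy `0`, `klSlotShift` on copy `1`. -/
def klSrcTransfer (β μ : ℝ) (K : TrigPolyC4v) (k : ℕ) : Matrix (SrcLabel L M (k + 1)) (SrcLabel L M k) ℂ :=
  Matrix.of fun p' p => if p'.2 = 0 ∧ p.2 = 0 then klReanalysis L M β μ K k p'.1 p.1
    else if p'.2 = 1 ∧ p.2 = 1 then klSlotShift L M k p'.1 p.1 else 0

/-! ## §2 The actions of the tower and the induction state -/

/-- **`D_{k+1}`**: the doubled source-carrying action of scale `k+1` analysed at level `k`, `map (toLin' (ε • klSrcAnalysisAt … k)) 𝒱_{k+1}[K]`. -/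
def klTowerD (β U μ : ℝ) (K : TrigPolyC4v) (k : ℕ) : GrassmannAlgebra ℂ (SrcLabel L M k) :=
  ExteriorAlgebra.map (Matrix.toLin' ((((imagTimeWeight β M : ℝ) : ℂ)) • klSrcAnalysisAt L M β μ K k)) (klEffectiveAction L M β U μ K klE0 (k + 1))

/-- **The transfer the state of step `j` is re-analysed with**: the identity at `j = 0`, `T⁺_k` at `j = k+1`. -/
def klTowerTransfer (β μ : ℝ) (K : TrigPolyC4v) : (j : ℕ) → Matrix (SrcLabel L M j) (SrcLabel L M (j - 1)) ℂ
  | 0 => 1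
  | k + 1 => klSrcTransfer L M β μ K k

/-- **The state of the induction at step `j`**: `D_1` at `j = 0`, `A_{k+1} = effAction C⁺_k D_{k+1}` at `j = k+1`. -/
def klTowerState (β U μ : ℝ) (K : TrigPolyC4v) : (j : ℕ) → GrassmannAlgebra ℂ (SrcLabel L M (j - 1))
  | 0 => klTowerD L M β U μ K 0
  | k + 1 => effAction ℂ (klStepCovD L M β μ K k) (klTowerD L M β U μ K k)

/-! ## §3 Unfoldings -/

variable {L M}

omit [NeZero M] in
/-- Entries of the spectator lift. -/
theorem klStepCovD_apply (β μ : ℝ) (K : TrigPolyC4v) (k : ℕ) (p q : SrcLabel L M k) :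
    klStepCovD L M β μ K k p q = if p.2 = 0 ∧ q.2 = 0 then klStepCov L M β μ K k p.1 q.1 else 0 := rfl

omit [NeZero L] [NeZero M] in
/-- Entries of the slot shift. -/
theorem klSlotShift_apply (k : ℕ) (Y' : SpaceTimeIdx L M × SectorLeg (sectorCount (k + 1))) (Y : SpaceTimeIdx L M × SectorLeg (sectorCount k)) :
    klSlotShift L M k Y' Y = if Y'.1 = Y.1 ∧ (Y'.2.1.1 : ℕ) = 0 ∧ (Y.2.1.1 : ℕ) = 0 ∧ Y'.2.1.2 = Y.2.1.2 ∧ Y'.2.2 = Y.2.2 then 1 else 0 := rfl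

omit [NeZero M] in
/-- Entries of the doubled transfer. -/
theorem klSrcTransfer_apply (β μ : ℝ) (K : TrigPolyC4v) (k : ℕ) (p' : SrcLabel L M (k + 1)) (p : SrcLabel L M k) :
    klSrcTransfer L M β μ K k p' p = if p'.2 = 0 ∧ p.2 = 0 then klReanalysis L M β μ K k p'.1 p.1
      else if p'.2 = 1 ∧ p.2 = 1 then klSlotShift L M k p'.1 p.1 else 0 := rfl

omit [NeZero M] in
/-- The re-analysis block as `ε • (E · S)`. -/
theorem klReanalysis_eq_smul (β μ : ℝ) (K : TrigPolyC4v) (k : ℕ) :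
    klReanalysis L M β μ K k = (((imagTimeWeight β M : ℝ) : ℂ)) •
      (sectorAnalysisMatrix L M β (klAnisoFamily L M β μ K klE0 (k + 1)) * sectorSubMatrix L M β (bgmFatMultiplier L M klE0 β (nambuXiCT L μ K) k)) := by
  rw [klReanalysis, Matrix.smul_mul]

omit [NeZero M] in
/-- The state at step `0` is `D_1`. -/
theorem klTowerState_zero (β U μ : ℝ) (K : TrigPolyC4v) : klTowerState L M β U μ K 0 = klTowerD L M β U μ K 0 := rfl

omit [NeZero M] in
/-- The state at step `k+1` is `A_{k+1} = effAction C⁺_k D_{k+1}`. -/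
theorem klTowerState_succ (β U μ : ℝ) (K : TrigPolyC4v) (k : ℕ) :
    klTowerState L M β U μ K (k + 1) = effAction ℂ (klStepCovD L M β μ K k) (klTowerD L M β U μ K k) := rfl

omit [NeZero M] in
/-- The transfer at step `0` is the identity. -/
theorem klTowerTransfer_zero (β μ : ℝ) (K : TrigPolyC4v) : klTowerTransfer L M β μ K 0 = 1 := rfl

omit [NeZero M] in
/-- The transfer at step `k+1` is `T⁺_k`. -/
theorem klTowerTransfer_succ (β μ : ℝ) (K : TrigPolyC4v) (k : ℕ) : klTowerTransfer L M β μ K (k + 1) = klSrcTransfer L M β μ K k := rfl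

/-! ## §4 The tower identity and the step shape -/

/-- **`D_{k+2} = map T⁺_k (effAction C⁺_k D_{k+1})`** (p588642 `…SrcTowerIdentity.klSrcTower_succ_eq_map_doubleBlock_effAction` for the named objects), given
`Z^K_{Λ_{k+1}} ≠ 0` and `β ≠ 0`. [cite: BenfattoGiulianiMastropietro2006, §2.7 (2.70)-(2.71)] -/
theorem klTowerD_succ_eq_map {β : ℝ} (hβ : β ≠ 0) (U μ : ℝ) (K : TrigPolyC4v) (k : ℕ)
    (hZ : hubbardEffPartitionFnCT L M β U μ 0 K (klScale klE0 (k + 1)) ≠ 0) :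
    klTowerD L M β U μ K (k + 1) =
      ExteriorAlgebra.map (Matrix.toLin' (klSrcTransfer L M β μ K k)) (effAction ℂ (klStepCovD L M β μ K k) (klTowerD L M β U μ K k)) :=
  klSrcTower_succ_eq_map_doubleBlock_effAction hβ U μ K k hZ (klStepCovD L M β μ K k) (fun _ _ => rfl) (klSlotShift L M k) (fun _ _ => rfl)
    (klSrcTransfer L M β μ K k) (fun _ _ => rfl)

/-- **`map T_j (state j) = klTowerD j`**: at `j = 0` the identity re-analysis of `D_1`, at `j = k+1` the tower identity. -/
theorem map_klTowerTransfer_klTowerState {β : ℝ} (hβ : β ≠ 0) (U μ : ℝ) (K : TrigPolyC4v) (j : ℕ)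
    (hZ : ∀ k, j = k + 1 → hubbardEffPartitionFnCT L M β U μ 0 K (klScale klE0 (k + 1)) ≠ 0) :
    ExteriorAlgebra.map (Matrix.toLin' (klTowerTransfer L M β μ K j)) (klTowerState L M β U μ K j) = klTowerD L M β U μ K j := by
  cases j with
  | zero =>
    show ExteriorAlgebra.map (Matrix.toLin' (1 : Matrix (SrcLabel L M 0) (SrcLabel L M 0) ℂ)) (klTowerD L M β U μ K 0) = klTowerD L M β U μ K 0
    rw [Matrix.toLin'_one, ExteriorAlgebra.map_id, AlgHom.id_apply]
  | succ k => exact (klTowerD_succ_eq_map hβ U μ K k (hZ k rfl)).symm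

/-- **The step shape**: `state (j+1) = effAction C⁺_j (map T_j (state j))` — the output of `…SrcSectorScaleSuccBundledP` at `𝒲 := state j`,
`Tpc := T_j`, `Cd := C⁺_j`. -/
theorem klTowerState_succ_eq_effAction_map {β : ℝ} (hβ : β ≠ 0) (U μ : ℝ) (K : TrigPolyC4v) (j : ℕ)
    (hZ : ∀ k, j = k + 1 → hubbardEffPartitionFnCT L M β U μ 0 K (klScale klE0 (k + 1)) ≠ 0) :
    klTowerState L M β U μ K (j + 1) =
      effAction ℂ (klStepCovD L M β μ K j) (ExteriorAlgebra.map (Matrix.toLin' (klTowerTransfer L M β μ K j)) (klTowerState L M β U μ K j)) := by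
  rw [map_klTowerTransfer_klTowerState hβ U μ K j hZ]; rfl

/-! ## §5 Periodisation across two volumes at a common frame -/

/-- **The re-analysis blocks of two volumes at a common frame are related by periodisation**: the fine preimage sum of `klReanalysis L″` over a label
fibre is the coarse entry of `klReanalysis L` (sampled families, `sectorOverlap_periodise_leg`). -/
theorem klReanalysis_periodise {b Lf : ℕ} [NeZero Lf] (hLf : Lf = b * L) {β : ℝ} (hβ : β ≠ 0) (μ : ℝ) (K : TrigPolyC4v) (k : ℕ)
    (e : (SpaceTimeIdx Lf M × SectorLeg (sectorCount (k + 1))) ≃ (Fin 2 → Fin b) × (SpaceTimeIdx L M × SectorLeg (sectorCount (k + 1))))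
    (he2 : ∀ X', (e X').2 = ((X'.1.1, fun i => (((X'.1.2 i).val : ℕ) : ZMod L)), X'.2))
    (e₁ : (SpaceTimeIdx Lf M × SectorLeg (sectorCount k)) ≃ (Fin 2 → Fin b) × (SpaceTimeIdx L M × SectorLeg (sectorCount k)))
    (he₁2 : ∀ X', (e₁ X').2 = ((X'.1.1, fun i => (((X'.1.2 i).val : ℕ) : ZMod L)), X'.2))
    (X' : SpaceTimeIdx Lf M × SectorLeg (sectorCount (k + 1))) (Y : SpaceTimeIdx L M × SectorLeg (sectorCount k)) :
    ∑ Y'' ∈ univ.filter (fun Y'' : SpaceTimeIdx Lf M × SectorLeg (sectorCount k) => (e₁ Y'').2 = Y), klReanalysis Lf M β μ K k X' Y'' =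
      klReanalysis L M β μ K k (e X').2 Y := by
  classical
  simp only [klReanalysis_eq_smul, Matrix.smul_apply, smul_eq_mul, ← mul_sum]
  rw [sectorOverlap_periodise_leg hLf hβ
    (fun (ω' : Fin (sectorCount (k + 1))) (i' : MatsubaraIdx M) (p : Fin 2 → ℝ) =>
      (((gnScaleCutoff 4 klE0 (-((k + 1 : ℕ) : ℤ)) (Real.sqrt (matsubaraFreq β M i' ^ 2 + (-2 * ∑ l, Real.cos (p l) - μ - K.eval p) ^ 2)) *
          sectorWeightCirc (k + 1) ω' (polarAngle (fun l => toIocMod Real.two_pi_pos (-Real.pi) (p l))) : ℝ) : ℂ)))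
    (fun (ω' : Fin (sectorCount k)) (i' : MatsubaraIdx M) (p : Fin 2 → ℝ) =>
      (((gnScaleCutoff 4 klE0 (-(k : ℤ) + 1) (Real.sqrt (matsubaraFreq β M i' ^ 2 + (-2 * ∑ l, Real.cos (p l) - μ - K.eval p) ^ 2)) *
          ∑ ω'' ∈ (range (sectorCount k)).filter
            (fun ω'' : ℕ => ∃ δ : ℤ, |δ| ≤ 1 ∧ (sectorCount k : ℤ) ∣ ((ω'' : ℤ) - ((ω' : ℕ) : ℤ) - δ)),
            sectorWeightCirc k ω'' (polarAngle (fun l => toIocMod Real.two_pi_pos (-Real.pi) (p l))) : ℝ) : ℂ)))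
    (klAnisoFamily L M β μ K klE0 (k + 1)) (klAnisoFamily Lf M β μ K klE0 (k + 1))
    (fun ω i q => klAnisoFamily_eq_sampled β μ K klE0 (k + 1) ω i q) (fun ω i q => klAnisoFamily_eq_sampled β μ K klE0 (k + 1) ω i q)
    (bgmFatMultiplier L M klE0 β (nambuXiCT L μ K) k) (bgmFatMultiplier Lf M klE0 β (nambuXiCT Lf μ K) k)
    (fun ω i q => bgmFatMultiplier_nambuXiCT_eq_sampled klE0 β μ K k ω i q) (fun ω i q => bgmFatMultiplier_nambuXiCT_eq_sampled klE0 β μ K k ω i q)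
    e₁ he₁2 X' Y, he2]

omit [NeZero L] [NeZero M] in
/-- **The slot shifts of two volumes are related by periodisation.** [folklore] -/
theorem klSlotShift_periodise {b Lf : ℕ} [NeZero Lf] (k : ℕ)
    (e : (SpaceTimeIdx Lf M × SectorLeg (sectorCount (k + 1))) ≃ (Fin 2 → Fin b) × (SpaceTimeIdx L M × SectorLeg (sectorCount (k + 1))))
    (he2 : ∀ X', (e X').2 = ((X'.1.1, fun i => (((X'.1.2 i).val : ℕ) : ZMod L)), X'.2))
    (e₁ : (SpaceTimeIdx Lf M × SectorLeg (sectorCount k)) ≃ (Fin 2 → Fin b) × (SpaceTimeIdx L M × SectorLeg (sectorCount k)))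
    (he₁2 : ∀ X', (e₁ X').2 = ((X'.1.1, fun i => (((X'.1.2 i).val : ℕ) : ZMod L)), X'.2))
    (X' : SpaceTimeIdx Lf M × SectorLeg (sectorCount (k + 1))) (Y : SpaceTimeIdx L M × SectorLeg (sectorCount k)) :
    ∑ Y'' ∈ univ.filter (fun Y'' : SpaceTimeIdx Lf M × SectorLeg (sectorCount k) => (e₁ Y'').2 = Y), klSlotShift Lf M k X' Y'' =
      klSlotShift L M k (e X').2 Y := by
  classical
  -- the only candidate in the fibre: the label with the site of `X′` and the legs of `Y`
  set Y₀ : SpaceTimeIdx Lf M × SectorLeg (sectorCount k) := (X'.1, Y.2) with hY₀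
  have hres : (e₁ Y₀).2 = ((X'.1.1, fun i => (((X'.1.2 i).val : ℕ) : ZMod L)), Y.2) := by rw [he₁2]
  rw [klSlotShift_apply, he2]
  by_cases hc : ((X'.1.1, fun i => (((X'.1.2 i).val : ℕ) : ZMod L)) = Y.1 ∧ (X'.2.1.1 : ℕ) = 0 ∧ (Y.2.1.1 : ℕ) = 0 ∧ X'.2.1.2 = Y.2.1.2 ∧ X'.2.2 = Y.2.2)
  · rw [if_pos hc]
    have hmem : Y₀ ∈ univ.filter (fun Y'' : SpaceTimeIdx Lf M × SectorLeg (sectorCount k) => (e₁ Y'').2 = Y) := by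
      rw [mem_filter]; refine ⟨mem_univ _, ?_⟩
      rw [hres]; exact Prod.ext hc.1 rfl
    rw [← add_sum_erase _ _ hmem, klSlotShift_apply, if_pos ⟨rfl, hc.2.1, hc.2.2.1, hc.2.2.2.1, hc.2.2.2.2⟩]
    rw [sum_eq_zero, add_zero]
    intro Y'' hY''
    rw [mem_erase, mem_filter] at hY''
    rw [klSlotShift_apply, if_neg]
    rintro ⟨h1, -, -, -, -⟩
    apply hY''.1
    -- same site and same residue-labels force `Y″ = Y₀`
    have h2 : Y''.2 = Y.2 := by have := congrArg Prod.snd hY''.2.2; rw [he₁2] at this; exact this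
    exact Prod.ext h1.symm h2
  · rw [if_neg hc]
    refine sum_eq_zero fun Y'' hY'' => ?_
    rw [mem_filter] at hY''
    rw [klSlotShift_apply, if_neg]
    rintro ⟨h1, h2, h3, h4, h5⟩
    apply hc
    have hr := hY''.2
    rw [he₁2] at hr
    have hY1 : Y.1 = (Y''.1.1, fun i => (((Y''.1.2 i).val : ℕ) : ZMod L)) := (congrArg Prod.fst hr).symm
    have hY2 : Y.2 = Y''.2 := (congrArg Prod.snd hr).symm
    refine ⟨?_, h2, ?_, ?_, ?_⟩
    · rw [hY1, ← h1]
    · rw [hY2]; exact h3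
    · rw [hY2]; exact h4
    · rw [hY2]; exact h5

omit [NeZero L] [NeZero M] in
/-- **The identity transfers of two volumes (step `0`) are related by periodisation** (same sector count on both sides). [folklore] -/
theorem one_periodise {b Lf N : ℕ} [NeZero Lf]
    (e : (SpaceTimeIdx Lf M × SectorLeg N) ≃ (Fin 2 → Fin b) × (SpaceTimeIdx L M × SectorLeg N))
    (X' : SpaceTimeIdx Lf M × SectorLeg N) (Y : SpaceTimeIdx L M × SectorLeg N) :
    ∑ Y'' ∈ univ.filter (fun Y'' : SpaceTimeIdx Lf M × SectorLeg N => (e Y'').2 = Y), (1 : Matrix _ _ ℂ) X' Y'' = (1 : Matrix _ _ ℂ) (e X').2 Y := by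
  classical
  rw [Finset.sum_filter]
  simp only [Matrix.one_apply]
  rw [Finset.sum_eq_single X']
  · by_cases h : (e X').2 = Y
    · rw [if_pos h, if_pos rfl, if_pos h]
    · rw [if_neg h, if_neg h]
  · intro Y'' _ hne; rw [if_neg (Ne.symm hne)]; split_ifs <;> rfl
  · intro h; exact absurd (mem_univ _) h

end Summit.HubbardSuperconductivity.HubbardSuperconductivity.Theorems.TwoVolumeSource

end
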